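import Summits.CriticalPhenomena.CardyFormulaZ2.Theorems.CardyBoundaryCoulombGasHalfPlaneMarkDensityLawReduction
import Summits.CriticalPhenomena.CardyFormulaZ2.Theorems.CardyBoundaryCoulombGasHalfPlaneMarkDensityLawBoxExhaustion
import Summits.CriticalPhenomena.CardyFormulaZ2.Theses.CardyPerronTeleport
import Mathlib.Analysis.SpecialFunctions.Trigonometric.Deriv
import Mathlib.Analysis.Calculus.Deriv.Slope

/-!
# Line `Sketch` — half-strip exhaustion: `HalfStripCardyZ2 → C⁺`
# (crux `HalfPlaneMarkDensityLaw`, stmt-CriticalPhenomena-5661, route CardyBoundaryCoulombGas)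

`HalfStripCardyZ2` (stmt-CriticalPhenomena-5178, the TARGET of the sibling route CardyPerronTeleport) is
Cardy's formula for bond-`ℤ²` at `p = 1/2` on half-strip ends: for `0 ≤ ξ₀ < ξ₁ < ξ₂ < ξ₃ ≤ 1` the
probability that the bottom arcs `[⌊ξ₀N⌋, ⌊ξ₁N⌋] × {0}` and `[⌊ξ₂N⌋, ⌊ξ₃N⌋] × {0}` of the lattice
half-strip `{0, …, N} × ℕ` are joined by an open path of the half-strip tends to
`F(crossRatio(−cos πξᵢ))`.  This file proves that it implies the one open stub of the line, C⁺
(collinear half-plane Cardy for bond-`ℤ²`):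

  `∀ a < b < c < y`, `P_{1/2}[[⌊an⌋,⌊bn⌋]×{0} ↔ [⌊cn⌋,⌊yn⌋]×{0} in ℤ×ℕ] → F(η(a,b,c,y))`,

by RSW HALF-STRIP EXHAUSTION.  Fix the marks `q = (a,b,c,y)` and `M = ⌈|a|⌉+⌈|b|⌉+⌈|c|⌉+⌈|y|⌉+1`.
For `L ≥ 1` read `HalfStripCardyZ2` at width `N = 2MLn` with the marks `ξᵢ = (ML + qᵢ)/(2ML)`:
then `⌊ξᵢ N⌋ = MLn + ⌊qᵢ n⌋` exactly, so the half-strip event is the translate by `(MLn, 0)` of the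
crossing of the CENTRED half-strip `[-MLn, MLn] × ℕ` between the arcs of C⁺ (translation invariance,
`real_openCrossing_shift`): `P_n^{(L)} → F(η_L)`, `η_L = crossRatio(sin(π qᵢ/(2ML)))`.  A centred
half-strip crossing is a half-plane crossing (LOWER bound), and a half-plane crossing that is not a
centred half-strip crossing joins `Λ_{Mn} ⊇ A_n` to the complement of `Λ_{MLn}`, probability
`≤ C L^{-α}` (`exists_real_boxToFar_le_rpow_of_le_half`; UPPER bound).  Finally
`η_L = crossRatio((2ML/π) sin(π qᵢ/(2ML))) → crossRatio q` (`sin θq/θ → q`, affine invariance and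
continuity of the cross-ratio) and `F` is continuous on `(0,1)`; the sandwich criterion gives C⁺.

Consequences: stmt-5178 ⟹ stmt-5661 (`HalfPlaneMarkDensityLaw`, by the landed `stub_reduction`), hence
(tree files `…WiredCardy`, `…OneArmThirdOfCrux`) ⟹ stmt-9321 (`HalfPlaneWiredCardy`) and stmt-5662
(`HalfPlaneOneArmThird`): the half-plane family of the CardyFormulaZ2 routes hangs below the half-strip
target as well as below `RectilinearCardy` (stmt-5660).
-/

noncomputable section

namespace Summit.CriticalPhenomena.CardyFormulaZ2.Cruxes.HalfPlaneMarkDensityLaw.SketchLine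

open Set MeasureTheory Filter
open Literature.Probability.LatticeModels
open Literature.Probability.Percolation hiding cardyFunction
open Literature.Probability.RandomPlanarGeometry
open Summit.CriticalPhenomena.CardyFormulaZ2.Theorems.HalfPlaneMarkDensityLaw.Negative
open Summit.CriticalPhenomena.CardyFormulaZ2.Theses.CardyPerronTeleport (HalfStripCardyZ2)
open scoped Topology

namespace HalfStrip

/-! ## The marks `ξᵢ = (K + qᵢ)/(2K)` of `HalfStripCardyZ2` read at half-width `K` -/

/-- `ξ` is strictly increasing when `q` is (`K ≥ 1`). [folklore] -/
theorem strictMono_marks {q : Fin 4 → ℝ} (hq : StrictMono q) {K : ℕ} (hK : 1 ≤ K) :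
    StrictMono (fun i ↦ ((K : ℝ) + q i) / (2 * K)) := by
  intro i j hij
  have hK' : (0 : ℝ) < K := by exact_mod_cast hK
  exact div_lt_div_of_pos_right (by linarith [hq hij]) (by positivity)

/-- `0 ≤ ξ₀` once `-K ≤ q₀`. [folklore] -/
theorem mark_zero_nonneg {q : Fin 4 → ℝ} {K : ℕ} (hK : 1 ≤ K) (h : -(K : ℝ) ≤ q 0) :
    0 ≤ (fun i ↦ ((K : ℝ) + q i) / (2 * K)) 0 := by
  have hK' : (0 : ℝ) < K := by exact_mod_cast hK
  exact div_nonneg (by linarith) (by positivity)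

/-- `ξ₃ ≤ 1` once `q₃ ≤ K`. [folklore] -/
theorem mark_three_le_one {q : Fin 4 → ℝ} {K : ℕ} (hK : 1 ≤ K) (h : q 3 ≤ K) :
    (fun i ↦ ((K : ℝ) + q i) / (2 * K)) 3 ≤ 1 := by
  have hK' : (0 : ℝ) < K := by exact_mod_cast hK
  show ((K : ℝ) + q 3) / (2 * K) ≤ 1
  rw [div_le_one (by positivity)]
  linarith

/-- `ξ · (2Kn) = Kn + r n` for the mark `ξ = (K + r)/(2K)`. [folklore] -/
theorem mark_mul {K : ℕ} (hK : 1 ≤ K) (n : ℕ) (r : ℝ) :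
    ((K : ℝ) + r) / (2 * K) * ((2 * (K * n) : ℕ) : ℝ) = ((K * n : ℕ) : ℝ) + r * n := by
  have hK' : (K : ℝ) ≠ 0 := by positivity
  push_cast
  field_simp

/-- The floors of the half-strip marks: `⌊ξ · 2Kn⌋₊ = Kn + ⌊r n⌋` once `-K ≤ r`. [folklore] -/
theorem floor_mark_mul {K : ℕ} (hK : 1 ≤ K) (n : ℕ) {r : ℝ} (h : -(K : ℝ) ≤ r) :
    ((⌊((K : ℝ) + r) / (2 * K) * ((2 * (K * n) : ℕ) : ℝ)⌋₊ : ℕ) : ℤ) = ((K * n : ℕ) : ℤ) + ⌊r * n⌋ := by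
  rw [mark_mul hK n r]
  have hn : (0 : ℝ) ≤ n := Nat.cast_nonneg n
  have h0 : (0 : ℝ) ≤ ((K * n : ℕ) : ℝ) + r * n := by
    have : -(K : ℝ) * n ≤ r * n := mul_le_mul_of_nonneg_right h hn
    push_cast; nlinarith
  rw [Int.natCast_floor_eq_floor h0,
    show ((K * n : ℕ) : ℝ) = (((K * n : ℕ) : ℤ) : ℝ) from (Int.cast_natCast _).symm,
    Int.floor_intCast_add]

/-! ## Translation: the half-strip event at width `2R` is the translate of the centred event -/

/-- The half-strip `{0,…,2R} × ℕ` is the translate by `(R, 0)` of the centred half-strip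
`[-R, R] × ℕ`. [folklore] -/
theorem halfStrip_eq_image (R : ℕ) :
    {v : Site 2 | 0 ≤ v 0 ∧ v 0 ≤ ((2 * R : ℕ) : ℤ) ∧ 0 ≤ v 1} =
      (· + (![(R : ℤ), 0] : Site 2)) '' {v : Site 2 | 0 ≤ v 1 ∧ -(R : ℤ) ≤ v 0 ∧ v 0 ≤ R} := by
  rw [BoxExhaustion.image_add_eq]
  ext v
  simp only [mem_setOf_eq, Pi.sub_apply, Matrix.cons_val_zero, Matrix.cons_val_one, sub_zero]
  push_cast
  omega

/-- A bottom arc `[R + k₀, R + k₁] × {0}` is the translate by `(R, 0)` of `[k₀, k₁] × {0}`. [folklore] -/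
theorem arc_eq_image (R : ℕ) (k₀ k₁ : ℤ) :
    {v : Site 2 | v 1 = 0 ∧ (R : ℤ) + k₀ ≤ v 0 ∧ v 0 ≤ (R : ℤ) + k₁} =
      (· + (![(R : ℤ), 0] : Site 2)) '' rowIcc k₀ k₁ := by
  rw [BoxExhaustion.image_add_eq]
  ext v
  simp only [mem_setOf_eq, rowIcc, Pi.sub_apply, Matrix.cons_val_zero, Matrix.cons_val_one, sub_zero]
  omega

/-- **`HalfStripCardyZ2` read on the centred half-strips `[-Kn, Kn] × ℕ`.** For marks `q = (a,b,c,y)`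
in `[-K, K]`: `P_{1/2}[A_n ↔ [⌊cn⌋,⌊yn⌋]×{0} in [-Kn,Kn]×ℕ] → F(crossRatio(−cos π ξᵢ))`,
`ξᵢ = (K + qᵢ)/(2K)` (translation invariance of `P_{1/2}`). [folklore] -/
theorem tendsto_cstrip (hHS : HalfStripCardyZ2) {a b c y : ℝ} (hab : a < b) (hbc : b < c)
    (hcy : c < y) {K : ℕ} (hK : 1 ≤ K) (ha : -(K : ℝ) ≤ a) (hy : y ≤ K) :
    Tendsto (fun n : ℕ ↦ μ.real (openCrossing
        {v : Site 2 | 0 ≤ v 1 ∧ -((K * n : ℕ) : ℤ) ≤ v 0 ∧ v 0 ≤ ((K * n : ℕ) : ℤ)}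
        (arcA a b n) (rowIcc ⌊c * n⌋ ⌊y * n⌋)))
      atTop (𝓝 (cardyFunction (crossRatio fun i ↦
        -Real.cos (Real.pi * (((K : ℝ) + (![a, b, c, y] : Fin 4 → ℝ) i) / (2 * K)))))) := by
  set q : Fin 4 → ℝ := ![a, b, c, y] with hq
  have hq0 : q 0 = a := by simp [hq]
  have hq1 : q 1 = b := by simp [hq]
  have hq2 : q 2 = c := by simp [hq]
  have hq3 : q 3 = y := by simp [hq]
  have hmono : StrictMono q := by rw [hq]; exact BoxExhaustion.strictMono_marks hab hbc hcy
  have hqK : ∀ i, -(K : ℝ) ≤ q i := fun i ↦ by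
    have hi : q 0 ≤ q i := hmono.monotone (Fin.zero_le i)
    rw [hq0] at hi
    exact ha.trans hi
  have h := hHS (fun i ↦ ((K : ℝ) + q i) / (2 * K)) (strictMono_marks hmono hK)
    (mark_zero_nonneg hK (by rw [hq0]; exact ha)) (mark_three_le_one hK (by rw [hq3]; exact hy))
  have hcomp : Tendsto (fun n : ℕ ↦ 2 * (K * n)) atTop atTop :=
    tendsto_atTop_atTop.2 fun m ↦ ⟨m, fun n hn ↦ by
      have h1 := Nat.mul_le_mul_right n hK
      rw [one_mul] at h1
      linarith⟩
  refine (h.comp hcomp).congr fun n ↦ ?_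
  have eA : rowIcc ⌊a * n⌋ ⌊b * n⌋ = arcA a b n := rfl
  simp only [Function.comp_apply]
  rw [floor_mark_mul hK n (hqK 0), floor_mark_mul hK n (hqK 1), floor_mark_mul hK n (hqK 2),
    floor_mark_mul hK n (hqK 3), hq0, hq1, hq2, hq3, halfStrip_eq_image, arc_eq_image, arc_eq_image, eA]
  exact real_openCrossing_shift (d := 2) half (![((K * n : ℕ) : ℤ), 0] : Site 2)
    {v : Site 2 | 0 ≤ v 1 ∧ -((K * n : ℕ) : ℤ) ≤ v 0 ∧ v 0 ≤ ((K * n : ℕ) : ℤ)} (arcA a b n)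
    (rowIcc ⌊c * n⌋ ⌊y * n⌋)

/-! ## The lattice sandwich at a fixed half-width -/

/-- The marks' box: every site of `A_n` lies in `Λ_{Mn}` for `M ≥ ⌈|a|⌉ + ⌈|b|⌉ + 1`. [folklore] -/
theorem arcA_subset_box {a b : ℝ} {M n : ℕ} (hM : ⌈|a|⌉₊ + ⌈|b|⌉₊ + 1 ≤ M) (hn : 1 ≤ n) :
    arcA a b n ⊆ (box 2 (M * n) : Set (Site 2)) := by
  intro v hv
  obtain ⟨hv1, hva, hvb⟩ := hv
  have h := BoxExhaustion.abs_le_of_floor_bounds hn hva hvb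
  have hMn : ((⌈|a|⌉₊ + ⌈|b|⌉₊ + 1 : ℕ) : ℤ) * n ≤ ((M * n : ℕ) : ℤ) := by
    push_cast
    exact mul_le_mul_of_nonneg_right (by exact_mod_cast hM) (by positivity)
  have h' : |v 0| ≤ ((M * n : ℕ) : ℤ) := h.trans hMn
  rw [Finset.mem_coe, mem_box]
  intro i
  fin_cases i
  · exact abs_le.1 h'
  · simp only [Fin.mk_one, Fin.isValue, hv1]
    constructor
    · exact neg_nonpos.2 (by positivity)
    · positivity

/-- UPPER inclusion: a half-plane crossing from `A_n ⊆ Λ_{Mn}` that is not a crossing of the centred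
half-strip `[-R, R] × ℕ`, `R ≥ Mn`, joins `Λ_{Mn}` to the complement of `Λ_R`. [folklore] -/
theorem diff_subset_escape {a b : ℝ} {M n R : ℕ} (hM : ⌈|a|⌉₊ + ⌈|b|⌉₊ + 1 ≤ M) (hn : 1 ≤ n)
    (hR : M * n ≤ R) (C : Set (Site 2)) :
    openCrossing halfPlane (arcA a b n) C \
        openCrossing {v : Site 2 | 0 ≤ v 1 ∧ -(R : ℤ) ≤ v 0 ∧ v 0 ≤ R} (arcA a b n) C ⊆
      {ω | ∃ x ∈ box 2 (M * n), ∃ y ∉ box 2 R, ω ∈ openConnIn univ x y} := by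
  rintro ω ⟨⟨x, hxA, z, hzC, hconn⟩, hF⟩
  have hxbox : x ∈ (box 2 (M * n) : Set (Site 2)) := arcA_subset_box hM hn hxA
  have hxbox' := hxbox
  rw [Finset.mem_coe, mem_box] at hxbox'
  have hxS : x ∈ {v : Site 2 | 0 ≤ v 1 ∧ -(R : ℤ) ≤ v 0 ∧ v 0 ≤ R} := by
    have h0 := hxbox' 0
    have hR' : ((M * n : ℕ) : ℤ) ≤ (R : ℤ) := by exact_mod_cast hR
    exact ⟨by rw [hxA.1], by omega, by omega⟩
  have hnot : ω ∉ openConnIn {v : Site 2 | 0 ≤ v 1 ∧ -(R : ℤ) ≤ v 0 ∧ v 0 ≤ R} x z :=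
    fun h ↦ hF ⟨x, hxA, z, hzC, h⟩
  obtain ⟨w, hwH, hwS, hw⟩ := BoxExhaustion.exists_exit_of_not_openConnIn hxS hconn hnot
  refine ⟨x, hxbox, w, fun hwbox ↦ hwS ?_, openConnIn_mono (subset_univ _) _ _ hw⟩
  rw [mem_box] at hwbox
  have h0 := hwbox 0
  exact ⟨hwH, h0.1, h0.2⟩

/-- UPPER bound at fixed scales: half-plane probability ≤ centred half-strip probability + escape
probability. [folklore] -/
theorem halfPlane_le {a b : ℝ} {M n R : ℕ} (hM : ⌈|a|⌉₊ + ⌈|b|⌉₊ + 1 ≤ M) (hn : 1 ≤ n)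
    (hR : M * n ≤ R) (C : Set (Site 2)) :
    μ.real (openCrossing halfPlane (arcA a b n) C) ≤
      μ.real (openCrossing {v : Site 2 | 0 ≤ v 1 ∧ -(R : ℤ) ≤ v 0 ∧ v 0 ≤ R} (arcA a b n) C) +
        μ.real {ω | ∃ x ∈ box 2 (M * n), ∃ y ∉ box 2 R, ω ∈ openConnIn univ x y} := by
  set E := openCrossing halfPlane (arcA a b n) C
  set F := openCrossing {v : Site 2 | 0 ≤ v 1 ∧ -(R : ℤ) ≤ v 0 ∧ v 0 ≤ R} (arcA a b n) C
  have hsplit : E ⊆ F ∪ (E \ F) := fun ω hω ↦ by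
    by_cases h : ω ∈ F
    · exact Or.inl h
    · exact Or.inr ⟨hω, h⟩
  calc μ.real E ≤ μ.real (F ∪ (E \ F)) := measureReal_mono hsplit (measure_ne_top _ _)
    _ ≤ μ.real F + μ.real (E \ F) := measureReal_union_le _ _
    _ ≤ _ := add_le_add le_rfl
        (measureReal_mono (diff_subset_escape hM hn hR C) (measure_ne_top _ _))

/-- LOWER bound at fixed scales: a crossing of the centred half-strip is a half-plane crossing.
[folklore] -/
theorem cstrip_le (R : ℕ) (A C : Set (Site 2)) :
    μ.real (openCrossing {v : Site 2 | 0 ≤ v 1 ∧ -(R : ℤ) ≤ v 0 ∧ v 0 ≤ R} A C) ≤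
      μ.real (openCrossing halfPlane A C) :=
  measureReal_mono (openCrossing_mono (fun _ hv ↦ hv.1) subset_rfl subset_rfl) (measure_ne_top _ _)

/-! ## Asymptotics of the half-strip modulus: `crossRatio(−cos π ξᵢ) → crossRatio q` -/

/-- `−cos(π (K + q)/(2K)) = sin((π/(2K)) q)`. [folklore] -/
theorem neg_cos_mark {K : ℝ} (hK : K ≠ 0) (q : ℝ) :
    -Real.cos (Real.pi * ((K + q) / (2 * K))) = Real.sin (Real.pi / (2 * K) * q) := by
  have e : Real.pi * ((K + q) / (2 * K)) = Real.pi / (2 * K) * q + Real.pi / 2 := by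
    field_simp
    ring
  rw [e, Real.cos_add_pi_div_two, neg_neg]

/-- `sin(θ q)/θ → q` as `θ → 0`, `θ ≠ 0`. [folklore] -/
theorem tendsto_inv_mul_sin (q : ℝ) :
    Tendsto (fun θ : ℝ ↦ θ⁻¹ * Real.sin (θ * q)) (𝓝[≠] 0) (𝓝 q) := by
  have h : HasDerivAt (fun θ : ℝ ↦ Real.sin (θ * q)) q 0 := by
    have := (hasDerivAt_mul_const (x := (0 : ℝ)) q).sin
    simpa using this
  have h2 := h.tendsto_slope_zero
  simp only [zero_add, zero_mul, Real.sin_zero, sub_zero, smul_eq_mul] at h2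
  exact h2

/-- The scales `θ_L = π/(2ML) → 0` within `ℝ ∖ {0}` as `L → ∞`. [folklore] -/
theorem tendsto_theta {M : ℕ} (hM : 1 ≤ M) :
    Tendsto (fun L : ℕ ↦ Real.pi / (2 * ((M * L : ℕ) : ℝ))) atTop (𝓝[≠] (0 : ℝ)) := by
  have hM' : (0 : ℝ) < M := by exact_mod_cast hM
  have h1 : Tendsto (fun L : ℕ ↦ Real.pi / (2 * M) / L) atTop (𝓝[>] (0 : ℝ)) :=
    BoxExhaustion.tendsto_div_nat_nhdsWithin (by positivity)
  have h2 : Tendsto (fun L : ℕ ↦ Real.pi / (2 * M) / L) atTop (𝓝[≠] (0 : ℝ)) :=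
    h1.mono_right (nhdsWithin_mono _ fun x hx ↦ ne_of_gt hx)
  refine h2.congr fun L ↦ ?_
  push_cast
  rw [div_div, mul_assoc]

/-- **The half-strip modulus tends to the half-plane modulus**: with `ξᵢ = (ML + qᵢ)/(2ML)`,
`F(crossRatio(−cos π ξᵢ)) → F(crossRatio q)` as `L → ∞`. [folklore] -/
theorem tendsto_cardy_marks {q : Fin 4 → ℝ} (hq : StrictMono q) {M : ℕ} (hM : 1 ≤ M) :
    Tendsto (fun L : ℕ ↦ cardyFunction (crossRatio fun i ↦
        -Real.cos (Real.pi * ((((M * L : ℕ) : ℝ) + q i) / (2 * ((M * L : ℕ) : ℝ))))))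
      atTop (𝓝 (cardyFunction (crossRatio q))) := by
  -- continuity of `F ∘ crossRatio` at `q`
  have hη : crossRatio q ∈ Ioo (0 : ℝ) 1 := crossRatio_mem_Ioo (Or.inl hq)
  have hF : ContinuousAt cardyFunction (crossRatio q) :=
    continuousOn_cardyFunction_Ioo.continuousAt (Ioo_mem_nhds hη.1 hη.2)
  have hcr : ContinuousAt crossRatio q :=
    BoxExhaustion.continuousAt_crossRatio (BoxExhaustion.crossRatio_den_ne_zero hq)
  -- the rescaled marks converge to `q`
  set θ : ℕ → ℝ := fun L ↦ Real.pi / (2 * ((M * L : ℕ) : ℝ)) with hθ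
  have hg : Tendsto (fun L : ℕ ↦ fun i ↦ (θ L)⁻¹ * Real.sin (θ L * q i)) atTop (𝓝 q) := by
    rw [tendsto_pi_nhds]
    intro i
    exact (tendsto_inv_mul_sin (q i)).comp (tendsto_theta hM)
  have hlim := hF.tendsto.comp (hcr.tendsto.comp hg)
  -- identify the two moduli for `L ≥ 1`
  refine hlim.congr' ?_
  filter_upwards [eventually_ge_atTop 1] with L hL
  have hK : ((M * L : ℕ) : ℝ) ≠ 0 := by positivity
  have hθ0 : θ L ≠ 0 := by rw [hθ]; positivity
  simp only [Function.comp_apply]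
  congr 1
  have e : (fun i ↦ -Real.cos (Real.pi * ((((M * L : ℕ) : ℝ) + q i) / (2 * ((M * L : ℕ) : ℝ))))) =
      fun i ↦ Real.sin (θ L * q i) := by
    funext i
    exact neg_cos_mark hK (q i)
  rw [e]
  have := crossRatio_affine (fun i ↦ Real.sin (θ L * q i)) (inv_ne_zero hθ0) 0
  simp only [add_zero] at this
  exact this

/-! ## The sandwich -/

/-- **`HalfStripCardyZ2 → C⁺`** in the line's vocabulary (half-strip exhaustion; module docstring).
[folklore] -/
theorem tendsto_halfPlane_crossing_of_halfStripCardyZ2 (hHS : HalfStripCardyZ2) {a b c y : ℝ}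
    (hab : a < b) (hbc : b < c) (hcy : c < y) :
    Tendsto (fun n : ℕ ↦ μ.real (openCrossing halfPlane (arcA a b n) (rowIcc ⌊c * n⌋ ⌊y * n⌋))) atTop
      (𝓝 (cardyFunction (crossRatio ![a, b, c, y]))) := by
  obtain ⟨C₀, α, -, hα, hesc⟩ := exists_real_boxToFar_le_rpow_of_le_half
  set M : ℕ := ⌈|a|⌉₊ + ⌈|b|⌉₊ + ⌈|c|⌉₊ + ⌈|y|⌉₊ + 1 with hM
  have hM1 : 1 ≤ M := by omega
  have hMab : ⌈|a|⌉₊ + ⌈|b|⌉₊ + 1 ≤ M := by omega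
  have hMa : |a| ≤ (M : ℝ) - 1 := by
    have := Nat.le_ceil |a|; rw [hM]; push_cast; linarith [Nat.cast_nonneg (α := ℝ) ⌈|b|⌉₊,
      Nat.cast_nonneg (α := ℝ) ⌈|c|⌉₊, Nat.cast_nonneg (α := ℝ) ⌈|y|⌉₊]
  have hMy : |y| ≤ (M : ℝ) - 1 := by
    have := Nat.le_ceil |y|; rw [hM]; push_cast; linarith [Nat.cast_nonneg (α := ℝ) ⌈|b|⌉₊,
      Nat.cast_nonneg (α := ℝ) ⌈|c|⌉₊, Nat.cast_nonneg (α := ℝ) ⌈|a|⌉₊]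
  have hmono : StrictMono (![a, b, c, y] : Fin 4 → ℝ) := BoxExhaustion.strictMono_marks hab hbc hcy
  set η := crossRatio (![a, b, c, y] : Fin 4 → ℝ) with hη
  refine BoxExhaustion.tendsto_of_sandwich fun ε hε ↦ ?_
  -- choose the half-width `L`
  have hlimL := tendsto_cardy_marks hmono hM1
  have e1 : ∀ᶠ L : ℕ in atTop, cardyFunction η - ε < cardyFunction (crossRatio fun i ↦
      -Real.cos (Real.pi * ((((M * L : ℕ) : ℝ) + (![a, b, c, y] : Fin 4 → ℝ) i) /
        (2 * ((M * L : ℕ) : ℝ))))) :=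
    hlimL (Ioi_mem_nhds (by linarith))
  have e2 : ∀ᶠ L : ℕ in atTop, cardyFunction (crossRatio fun i ↦
      -Real.cos (Real.pi * ((((M * L : ℕ) : ℝ) + (![a, b, c, y] : Fin 4 → ℝ) i) /
        (2 * ((M * L : ℕ) : ℝ))))) < cardyFunction η + ε :=
    hlimL (Iio_mem_nhds (by linarith))
  have e3 : ∀ᶠ L : ℕ in atTop, C₀ * ((L : ℝ)⁻¹) ^ α < ε :=
    (BoxExhaustion.tendsto_const_mul_inv_rpow C₀ hα) (Iio_mem_nhds hε)
  obtain ⟨L, hL1, hL2, hL3, hL⟩ := (e1.and (e2.and (e3.and (eventually_ge_atTop 1)))).exists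
  have hK : 1 ≤ M * L := Nat.one_le_iff_ne_zero.2 (by positivity)
  have hKr : (M : ℝ) ≤ ((M * L : ℕ) : ℝ) := by
    have : (1 : ℝ) ≤ L := by exact_mod_cast hL
    push_cast; nlinarith
  have haK : -(((M * L : ℕ) : ℝ)) ≤ a := by linarith [neg_abs_le a]
  have hyK : y ≤ ((M * L : ℕ) : ℝ) := by linarith [le_abs_self y]
  refine ⟨fun n ↦ μ.real (openCrossing
      {v : Site 2 | 0 ≤ v 1 ∧ -((M * L * n : ℕ) : ℤ) ≤ v 0 ∧ v 0 ≤ ((M * L * n : ℕ) : ℤ)}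
      (arcA a b n) (rowIcc ⌊c * n⌋ ⌊y * n⌋)),
    fun n ↦ μ.real (openCrossing
      {v : Site 2 | 0 ≤ v 1 ∧ -((M * L * n : ℕ) : ℤ) ≤ v 0 ∧ v 0 ≤ ((M * L * n : ℕ) : ℤ)}
      (arcA a b n) (rowIcc ⌊c * n⌋ ⌊y * n⌋)), _, _,
    tendsto_cstrip hHS hab hbc hcy hK haK hyK, tendsto_cstrip hHS hab hbc hcy hK haK hyK, hL1, hL2, ?_⟩
  filter_upwards [eventually_ge_atTop 1] with n hn
  refine ⟨cstrip_le _ _ _, ?_⟩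
  have hR : M * n ≤ M * L * n := by
    calc M * n = M * 1 * n := by ring
      _ ≤ M * L * n := by gcongr
  have h1 := halfPlane_le hMab hn hR (rowIcc ⌊c * n⌋ ⌊y * n⌋)
  have h2 : μ.real {ω | ∃ x ∈ box 2 (M * n), ∃ y ∉ box 2 (M * L * n), ω ∈ openConnIn univ x y} ≤
      C₀ * ((L : ℝ)⁻¹) ^ α := by
    have := BoxExhaustion.escape_le hesc hM1 hn hL
    rwa [show M * n * L = M * L * n by ring] at this
  linarith

end HalfStrip

/-- **Half-strip exhaustion: `HalfStripCardyZ2 → stub_collinearCardy`** (line `Sketch`, crux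
`HalfPlaneMarkDensityLaw`).  Cardy's formula for bond-`ℤ²` at `p = 1/2` on half-strip ends (the target
`HalfStripCardyZ2` of route CardyPerronTeleport, stmt-CriticalPhenomena-5178) implies the collinear
half-plane Cardy statement C⁺: for `a < b < c < y`,
`P_{1/2}[[⌊an⌋,⌊bn⌋]×{0} ↔ [⌊cn⌋,⌊yn⌋]×{0} in ℤ×ℕ] → F(η(a,b,c,y))`. [folklore] -/
theorem collinearCardy_of_halfStripCardyZ2 :
    Summit.CriticalPhenomena.CardyFormulaZ2.Theses.CardyPerronTeleport.HalfStripCardyZ2 →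
      (∀ a b c y : ℝ, a < b → b < c → c < y →
        Tendsto (fun n : ℕ ↦ μ.real (openCrossing halfPlane (arcA a b n) (rowIcc ⌊c * n⌋ ⌊y * n⌋)))
          atTop (𝓝 (Literature.Probability.RandomPlanarGeometry.cardyFunction
            (Literature.Probability.RandomPlanarGeometry.crossRatio ![a, b, c, y])))) :=
  fun hHS _ _ _ _ hab hbc hcy ↦
    HalfStrip.tendsto_halfPlane_crossing_of_halfStripCardyZ2 hHS hab hbc hcy

/-- **stmt-5178 ⇒ stmt-5661**: `HalfStripCardyZ2 → HalfPlaneMarkDensityLaw` — the target of route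
CardyPerronTeleport implies crux 5 of route CardyBoundaryCoulombGas BY NAME (half-strip exhaustion +
the landed reduction `stub_reduction`). [folklore] -/
theorem halfPlaneMarkDensityLaw_of_halfStripCardyZ2 :
    Summit.CriticalPhenomena.CardyFormulaZ2.Theses.CardyPerronTeleport.HalfStripCardyZ2 →
      Summit.CriticalPhenomena.CardyFormulaZ2.Theses.CardyBoundaryCoulombGas.HalfPlaneMarkDensityLaw :=
  fun h ↦ stub_reduction (collinearCardy_of_halfStripCardyZ2 h)

end Summit.CriticalPhenomena.CardyFormulaZ2.Cruxes.HalfPlaneMarkDensityLaw.SketchLine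

end
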